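import Literature.NumberTheory.Automorphic.Liu2021.Def411IrreducibleOfLemD1AsPrinted
import Literature.RepresentationTheory.MoeglinVignerasWaldspurger1987.RankOneThetaLift
import Literature.NumberTheory.Automorphic.Liu2021.LemD1DataOfPlaceIsometric
import Literature.NumberTheory.Automorphic.Liu2021.LemD1IsotropyOfPlace
import Literature.NumberTheory.Automorphic.Liu2021.LemD1SplitPlaceOfFacts
import Literature.RepresentationTheory.MoeglinVignerasWaldspurger1987.RankOneThetaLiftNonvanishingProofs
import Literature.RepresentationTheory.MoeglinVignerasWaldspurger1987.RankOneThetaLiftAdmissibleProofs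
import Literature.RepresentationTheory.MoeglinVignerasWaldspurger1987.RankOneThetaLiftIrreducibleProofs
import Literature.NumberTheory.Automorphic.Zelevinsky1980.UnitaryCharacterInductionIrreducible
import Literature.NumberTheory.Automorphic.Liu2021.SplitPlaceOscillatorModelUniform
import HarnessLib

/-!
**v7 (2026-08-28T02:00Z): stub (4) IV-2 CLOSED BY NAME := `mvw_IV2_rankOne_nonvanishing_of_isotropic_holds` (B-p04 p593652); texts byte-identical.**
**v8 (2026-08-28T02:30Z): stub (2) IV-1b CLOSED BY NAME := `mvw_IV4_rankOne_admissible_holds` (B-p03 p595885); keyed stub texts (1)(3a)(3b) byte-identical; 3 sorries.**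
**v10 (2026-08-28T03:58Z): stub (3a) IV-3a CLOSED BY NAME := `splitPlace_chiCoinv_iso_parabolicIndGL_holds` (B-p08 p602828/p603198, module
`Liu2021.SplitPlaceOscillatorModelUniform`) ⇒ 0 sorries: every stub of this line is a tree theorem; the route crux HD1pp (stmt-HodgeConjecture-24838) is
CLOSED proved by `Summit.HodgeConjecture.HodgeConjecture.Theorems.HD1pp_proof` (B-p01 p603347).**

**v9 (2026-08-28T03:35Z): stub (1) IV-1a CLOSED BY NAME := `mvw_IV4_rankOne_irreducibleOrZero_holds` (B-p02 p601137) and stub (3b) IV-3b := `Zelevinsky1980.parabolicIndGL_detChar_unitary_isIrreducible_holds` (B-p09 p601139); ONE sorry left = stub (3a) IV-3a `splitPlace_chiCoinv_iso_parabolicIndGL` (KEY B-p08); all stub texts byte-identical.  The junction §J and the composition §C of this file are in the TREE verbatim since p598746 (`Liu2021/LemD1Item1AtVOfFacts.lean`: `LemD1OfPlace.lemD1_1AsPrinted_data_of_theta`, `Def411WeilCarriers.lemD1_1AsPrinted_localLemD1Data_of`), consumed by the J-tree `Summit.HodgeConjecture.CorCM.HypD1pp.*` (p598544/p598915/p599149);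 HC_CM is proved only modulo the 7 printed citations until rung 0 closes.**
**v6 (2026-08-28T01:28Z): stub (5) CLOSED by `not_isAnisotropic_localLemD1Data` (B-p01 p590822); stub (3) CLOSED by
`splitPlace_model_consequences_of_facts` (B-p01 p592614) modulo the two interface facts IV-3(a)(b), now the fact-stubs (3a)(3b) of THIS file
(byte-identical to stubs (a)(b) of `b4-split-place-model`); stubs (1)(2)(4) byte-identical to v5.**

# Line `b4-lemD1-item1-at-v` — [Liu2021, Lem. D.1, first sentence + (1)] AT A FINITE PLACE, for `n ≥ 3`,
# from the local theta correspondence for the pair (U(1) = centre, U(V)) (fan B, rung B-IV; cell hodgecm-mathlib)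

SKELETON (crux workfile draft; binder served: `HypD1pp` = hD1'' — per place `v` it is LITERALLY
`LemD1_1AsPrinted (localLemD1Data … v)` at `N = 3`, `𝓢 = chiLocalSplittingsD …`; also the per-place input `hD1 v` of
`Def411WeilCarriers.rho_isIrreducible_of_lemD1AsPrinted'` for `Hyp411`).  WHY THIS LINE: at `n ≥ 3` the right-hand side of
Lem. D.1 (1) is `False` (`n = 2` fails), so the printed statement at the tree's local datum is EXACTLY «the maximal
`χ_v`-quotient of the honest local Weil representation `ω_v = 𝓢.omegaLoc v` is irreducible-or-zero ∧ admissible ∧ NON-ZERO»,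
and these three clauses are three DIFFERENT published theorems with disjoint proofs ([GanTakeda2016, p. 3 L67–75]:
«the techniques for proving the three statements … are quite disjoint»): Howe duality in the COMPACT case
[MoeglinVignerasWaldspurger1987, Chap. 3 IV.4 Thm principal 1a) + IV.7 (the case `m = 0`)], Kudla's admissibility ∕ finite length
[Kudla1986; MVW Chap. 3 IV.4 2a)], and stable-range occurrence [MVW Chap. 3 IV.2 Lemme] fed by the isotropy of hermitian spaces of
rank `≥ 3` over a non-archimedean local field.  STRATEGY tag: `howe-compact + split-model` — the stubs are CUT BY PLACE KIND in the tree's currency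
`IsField (LocalRing E v)` (non-split: MVW Chap. 3 IV = type 1, `D = E_v` a field, the member `U(W) = E_v¹` is COMPACT and is the centre of
`U(V)(F_v)`, so `Θ(χ)` is the `χ`-isotypic part of `ω_v|_{U(V)}` — no Jacquet modules of the small group; split: `E_v = F_v × F_v`, type 2 pair
`(GL_1, GL_n)`, where [Liu2021, proof of Lem. D.1, l. 5253; GelbartRogawski1990 §2.6] identify `ω(μ,ε,χ)` with the unitary induction
`Ind_{P_{n-1,1}}^{GL_n}((ν∘det) ⊠ χν^{1-n})`, irreducible by [BernsteinZelevinsky1977, Thm 4.2], admissible and non-zero as an induced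
representation).  Differs from a `kudla-filtration` line (MVW Chap. 3 IV.5 for general Witt index, not drafted) and from a `minguez-type2`
line (Howe duality for type 2 at split places instead of the explicit model, not drafted).

v3 (2026-08-28): RE-ALIGNED to B-typ01's named facts (p589403, `Literature/RepresentationTheory/MoeglinVignerasWaldspurger1987/RankOneThetaLift.lean`,
`TwistedCoinv` currency over smooth SECTIONS `s` over `iota`): the three non-split stubs ARE the facts (`stub_mvw_* : mvw_* `, closed by a
`theorem mvw_*_holds`), instantiated in the composition at `s := 𝓢.s v` (this certifies the consumer fit V7 in the kernel); the junction
(T) → (D) from `TwistedCoinv.rep χ_{1,v} (𝓢.omegaLoc v)` to the datum `localLemD1Data … v` is PROVED here (`Junction.lemD1_1AsPrinted_data_of_theta`,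
the converse of `LemD1OfPlace.isIrreducible_rep_of_lemD1_1AsPrinted` ∕ `isAdmissible_rep_…` ∕ `nontrivial_coinv_…`, all iff's in tree).
v4/v5 (2026-08-28T00:39Z/00:47Z, answering ref2 HOLDs 00:34:41Z + 00:41:05Z; v5 = `include hVd hn hχ₁n hχ₁c in` so the split stub keeps rank ≥ 3, det-unit and the unitarity/continuity of χ₁ in its elaborated statement): the split-place stub and the composition carry the UNITARITY hypothesis
`hL2 : (𝓢.omegaLoc v).IsL2Isometric (μ'ⁿ)` (`μ'` a Haar measure on `F_v`) — without it the split-place statement is false for the generic telescope `𝓢`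
(tree `Liu2021/LemD1DataOfPlaceIsometric.lean`); for the CM families it is the tree theorem
`GRConstruction.isL2Isometric_omegaLoc_congrW_undoubledSplittings_cmFinLocalFamily` (A-side discharge, one line).
Stubs `stub_*` are the registered open lemmas (sorried, sizes in the line card `b4-lemD1-item1-at-v.md`); the composition
`lemD1_1AsPrinted_localLemD1Data_of` is kernel-checked.  HC_CM is proved only modulo the 7 printed citations until rung 0
closes; nothing here changes that.
-/

set_option autoImplicit false

noncomputable section

open scoped Matrix Kronecker TensorProduct Classical RestrictedProduct
open NumberField NumberField.mixedEmbedding IsDedekindDomain Filter Set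
open Literature.NumberTheory.Automorphic Literature.NumberTheory.Automorphic.UnitaryGroup
open Literature.NumberTheory.Weil1964 Literature.RepresentationTheory
open Literature.RepresentationTheory.HeisenbergGroup
open Literature.GroupTheory.RestrictedProductCharacter
open Literature.NumberTheory Literature.NumberTheory.GelbartRogawski1991 Literature.NumberTheory.GelbartRogawski1991.UnitaryDualPair
open Literature.NumberTheory.GelbartRogawski1991.UnitaryDualPair.WeilCoinv
open Literature.NumberTheory.Automorphic.Liu2021 Literature.NumberTheory.Automorphic.Liu2021.Def411WeilCarriers
open Literature.RepresentationTheory.CentralCharacterQuotient (augmentation quotRep)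
open Literature.RepresentationTheory.MoeglinVignerasWaldspurger1987
open MeasureTheory

/-! ## §J The junction (T) → (D): from the theta lift `TwistedCoinv.rep χ ω hc` to Lemma D.1 (1) AS PRINTED for the datum (PROVED) -/

namespace HodgecmMathlib.B4.LemD1Item1AtV.Junction

open Literature.NumberTheory.Automorphic.Liu2021.LemD1OfPlace

variable {F : Type} (E : Type) [Field F] [NumberField F] [Field E] [NumberField E] [Algebra F E]
  [Algebra.IsQuadraticExtension F E] (v : HeightOneSpectrum (𝓞 F))
  (c : E ≃ₐ[F] E) (N : ℕ) (J : Matrix (Fin N) (Fin N) E)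
  {δ : E} (hcδ : c δ = -δ) (hδ : δ ≠ 0) (hN : 2 ≤ N) (hJh : (J.map c)ᵀ = J) (hJdet : J.det ≠ 0)
  (J₁ : Matrix (Fin 1) (Fin 1) E)
  {V : Type} [AddCommGroup V] [Module ℂ V] (ω : Representation ℂ (localPi E c N J v) V)
  (μ : (LocalRing E v)ˣ →* ℂˣ) (hμn : ∀ x, ‖((μ x : ℂˣ) : ℂ)‖ = 1) (hμc : Continuous fun x => ((μ x : ℂˣ) : ℂ))
  (hμF : ∀ a : (v.adicCompletion F)ˣ,
    μ (Units.map (algebraMap (v.adicCompletion F) (LocalRing E v)).toMonoidHom a) = 1 ↔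
      ∃ x : (LocalRing E v)ˣ, (x : LocalRing E v) * conjLocal E c v x =
        algebraMap (v.adicCompletion F) (LocalRing E v) a)
  (χ : localPi E c 1 J₁ v →* ℂˣ) (hχn : ∀ h, ‖((χ h : ℂˣ) : ℂ)‖ = 1) (hχc : Continuous fun h => ((χ h : ℂˣ) : ℂ))
  (hJ₁ : J₁ 0 0 ≠ 0)
  (hc : ∀ (g : localPi E c N J v) (h : localPi E c 1 J₁ v),
    Commute (ω g) ((show Representation ℂ (localPi E c 1 J₁ v) V from ω.comp (localCenter E c N J J₁ hJ₁ v)) h))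

/-- **JUNCTION (T) → (D), PROVED** — the converse of `LemD1OfPlace.isIrreducible_rep_of_lemD1_1AsPrinted`,
`isAdmissible_rep_of_lemD1_1AsPrinted`, `nontrivial_coinv_of_lemD1_1AsPrinted`: if the maximal `χ`-quotient `TwistedCoinv.rep χ ω hc` of
a representation `ω` of `U(J)(F_v)` along the local centre is irreducible-or-zero, admissible and NON-ZERO, and `N ≥ 3`, then
[Liu2021, App. D Lemma D.1, first sentence + (1)] holds AS PRINTED for the datum `LemD1OfPlace.data … ω μ … χ …` (in (1) both
sides are `False`: the space is non-zero, and `n = 2` contradicts `N ≥ 3`).  Four transports, each an `iff` already in the tree: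
the acting centre along `θ : E_v¹ ↠ U(J₁)(F_v)`, the group along `uEquiv : S.U ≃ₜ* localPi`, the identity of `V` as `mapEquiv`
(`coinvEquiv`), and `quotRep ↔ TwistedCoinv.rep` for the datum's own pair.
[cite: Liu2021, App. D Lemma D.1 (1) (l. 5226–5229), arXiv:2102.11518 chunk p0056 L21–L23] -/
theorem lemD1_1AsPrinted_data_of_theta (h3 : 3 ≤ N)
    (hirr : IsIrreducibleOrZero (TwistedCoinv.rep χ ω hc)) (hadm : (TwistedCoinv.rep χ ω hc).IsAdmissible)
    (hnt : Nontrivial (TwistedCoinv.Coinv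
      (show Representation ℂ (localPi E c 1 J₁ v) V from ω.comp (localCenter E c N J J₁ hJ₁ v)) χ)) :
    LemD1_1AsPrinted (data E v c N J hcδ hδ hN hJh hJdet J₁ ω μ hμn hμc hμF χ hχn hχc) := by
  -- (3) non-vanishing: centre along `θ`, then `coinvEquiv`, then `quotRep`'s space
  have hB := (nontrivial_coinv_iff_of_comp_surjective_right _ χ (theta E v c N J hcδ hδ hN hJh hJdet J₁)
    (theta_surjective E v c N J hcδ hδ hN hJh hJdet J₁ hJ₁)).2 hnt
  have hA := (coinvEquiv E v c N J hcδ hδ hN hJh hJdet J₁ ω μ hμn hμc hμF χ hχn hχc hJ₁).toEquiv.nontrivial_congr.2 hB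
  have hQ : Nontrivial (V ⧸ augmentation (data E v c N J hcδ hδ hN hJh hJdet J₁ ω μ hμn hμc hμF χ hχn hχc).omega
      (data E v c N J hcδ hδ hN hJh hJdet J₁ ω μ hμn hμc hμF χ hχn hχc).S.scalar
      (data E v c N J hcδ hδ hN hJh hJdet J₁ ω μ hμn hμc hμF χ hχn hχc).chi) :=
    (TwistedCoinv.nontrivial_quotRep_iff _ (standingData E v c N J hcδ hδ hN hJh hJdet).scalar _).2 hA
  -- (2) admissibility: centre along `θ`, group along `uEquiv`, `coinvEquiv`, `quotRep`
  have hadmC := (isAdmissible_rep_iff_of_comp_surjective_right _ χ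
    (theta E v c N J hcδ hδ hN hJh hJdet J₁) (theta_surjective E v c N J hcδ hδ hN hJh hJdet J₁ hJ₁) ω hc
    (commute_theta E v c N J hcδ hδ hN hJh hJdet J₁ ω hJ₁ hc)).2 hadm
  have hadmB := (isAdmissible_rep_comp_iff_of_continuousMulEquiv _ _ ω
      (commute_theta E v c N J hcδ hδ hN hJh hJdet J₁ ω hJ₁ hc) (uEquiv E v c N J hcδ hδ hN hJh hJdet)
      (commute_uEquiv_theta E v c N J hcδ hδ hN hJh hJdet J₁ ω hJ₁ hc)).2 hadmC
  have hadmA := (Representation.isAdmissible_iff_of_equivariant _ _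
      (coinvEquiv E v c N J hcδ hδ hN hJh hJdet J₁ ω μ hμn hμc hμF χ hχn hχc hJ₁)
      (coinvEquiv_rep E v c N J hcδ hδ hN hJh hJdet J₁ ω μ hμn hμc hμF χ hχn hχc hJ₁ hc)).2 hadmB
  have h2 := (TwistedCoinv.isAdmissible_quotRep_iff _ _
    (standingData E v c N J hcδ hδ hN hJh hJdet).scalar_mem_center _
    (commute_scalar E v c N J hcδ hδ hN hJh hJdet J₁ ω μ hμn hμc hμF χ hχn hχc)).2 hadmA
  -- (1) irreducibility: non-zero ⇒ irreducible, then the same four transports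
  haveI := hnt
  have hirrT : (TwistedCoinv.rep χ ω hc).IsIrreducible := isIrreducible_of_nontrivial hirr
  have hirrC := (TwistedCoinv.isIrreducible_rep_iff_of_comp_surjective_right _ χ
    (theta E v c N J hcδ hδ hN hJh hJdet J₁) (theta_surjective E v c N J hcδ hδ hN hJh hJdet J₁ hJ₁) ω hc
    (commute_theta E v c N J hcδ hδ hN hJh hJdet J₁ ω hJ₁ hc)).2 hirrT
  have hirrB := (TwistedCoinv.isIrreducible_rep_comp_iff_of_surjective _ _ ω
      (commute_theta E v c N J hcδ hδ hN hJh hJdet J₁ ω hJ₁ hc)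
      (uEquiv E v c N J hcδ hδ hN hJh hJdet).toMulEquiv.toMonoidHom (uEquiv E v c N J hcδ hδ hN hJh hJdet).surjective
      (commute_uEquiv_theta E v c N J hcδ hδ hN hJh hJdet J₁ ω hJ₁ hc)).2 hirrC
  have hirrA := (TwistedCoinv.isIrreducible_rep_iff_of_mapEquiv _ _ _ _ _ _
      (commute_scalar E v c N J hcδ hδ hN hJh hJdet J₁ ω μ hμn hμc hμF χ hχn hχc)
      (commute_uEquiv_theta E v c N J hcδ hδ hN hJh hJdet J₁ ω hJ₁ hc) (LinearEquiv.refl ℂ V) (fun _ => 1)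
      (acting_pairs_agree E v c N J hcδ hδ hN hJh hJdet J₁ ω μ hμn hμc hμF χ hχn hχc hJ₁)
      (chi_agree E v c N J hcδ hδ hN hJh hJdet J₁ ω μ hμn hμc hμF χ hχn hχc) (MonoidHom.id _)
      Function.surjective_id (fun _ => 1)
      (omega_agree E v c N J hcδ hδ hN hJh hJdet J₁ ω μ hμn hμc hμF χ hχn hχc)).2 hirrB
  have h1 := (TwistedCoinv.isIrreducible_quotRep_iff _ _
    (standingData E v c N J hcδ hδ hN hJh hJdet).scalar_mem_center _
    (commute_scalar E v c N J hcδ hδ hN hJh hJdet J₁ ω μ hμn hμc hμF χ hχn hχc)).2 hirrA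
  -- assembly of the printed conjunction
  refine ⟨⟨isIrreducibleOrZero_of_isIrreducible h1, h2⟩, iff_of_false (not_subsingleton _) ?_⟩
  rintro ⟨-, ⟨-, h2'⟩, -⟩
  omega

end HodgecmMathlib.B4.LemD1Item1AtV.Junction

/-! ## §S The stubs and the composition at the tree's local datum `localLemD1Data … v` -/

namespace HodgecmMathlib.B4.LemD1Item1AtV


variable (F E : Type) [Field F] [NumberField F] [Field E] [NumberField E] [Algebra F E]
variable (c : E ≃ₐ[F] E) (N : ℕ) {n : ℕ} (e : Fin N × Fin 1 ≃ Fin n)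
variable (JV : Matrix (Fin N) (Fin N) E) {TV : Matrix (Fin N) (Fin N) F}
variable [Algebra.IsQuadraticExtension F E] {δ : E} (hcδ : c δ = -δ) (hδ : δ ≠ 0) {d : F}
  (hd : δ * δ = algebraMap F E d) (hV : TV.IsSymm) (hVd : IsUnit TV.det) (hJV : JV = TV.map (algebraMap F E))
variable (a : Fˣ)
  (𝓢 : LocalSplitting.FinLocalSplittings F E c n hcδ hδ hd (gram F e TV (TW F a)) (isSymm_gram F e hV (isSymm_TW F a))
    (reindex_kronecker_eq_gram_map F E e hJV (JW_eq F E a)))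
  (hn : 3 ≤ n)
  (μ : ∀ v : HeightOneSpectrum (𝓞 F), (LocalRing E v)ˣ →* ℂˣ) (hμn : ∀ v x, ‖((μ v x : ℂˣ) : ℂ)‖ = 1)
  (hμc : ∀ v, Continuous fun x => ((μ v x : ℂˣ) : ℂ))
  (hμF : ∀ (v : HeightOneSpectrum (𝓞 F)) (t : (v.adicCompletion F)ˣ),
    μ v (Units.map (algebraMap (v.adicCompletion F) (LocalRing E v)).toMonoidHom t) = 1 ↔
      ∃ x : (LocalRing E v)ˣ, (x : LocalRing E v) * conjLocal E c v x = algebraMap (v.adicCompletion F) (LocalRing E v) t)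
  (χ₁ : UnitaryGroup.finAdelicOne F E c →* ℂˣ) (hχ₁n : ∀ u, ‖((χ₁ u : ℂˣ) : ℂ)‖ = 1) (hχ₁c : Continuous χ₁)
  (v : HeightOneSpectrum (𝓞 F))

/-- **stub (XL) = the named fact `mvw_IV4_rankOne_irreducibleOrZero`** — Howe duality, COMPACT member, at a NON-SPLIT place
[MoeglinVignerasWaldspurger1987, Chap. 3 IV.4 «Théorème principal» 1a) (chunk p0078 L17–21) with IV.7 (the case `m = 0`); GanTakeda2016 Thm. 1.2;
Howe1979 §9 («certainly true if G or G′ is compact»)]: for every smooth section `s` over `iota` and every continuous unitary `χ` of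
`U(J₁)(F_v) ≅ E_v¹`, the `χ`-coinvariant quotient `TwistedCoinv.rep χ ω_s _` of `ω_s = toRep ∘ s` along the local centre is irreducible or zero.
Closed by `theorem mvw_IV4_rankOne_irreducibleOrZero_holds : mvw_IV4_rankOne_irreducibleOrZero` (KEY `b4-howe-compact-irreducible`).  Mathlib has:
`Representation`, `Subrepresentation`, Haar measure on compact groups; tree has: `TwistedCoinv`, `compactSpace_localPi_one_of_smul_eq`, lattice ∕
Schrödinger models; lacks: the doubling see-saw ∕ matrix coefficients of `ω_v` (MVW Chap. 3 IV.7), equivalently multiplicity one of `χ ⊠ τ` in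
`ω_v|_{E_v¹ × U(V)}`.
[cite: MoeglinVignerasWaldspurger1987, Chap. 3 IV.4 Thm principal 1a), IV.7] -/
theorem stub_mvw_IV4_rankOne_irreducibleOrZero : mvw_IV4_rankOne_irreducibleOrZero :=
  mvw_IV4_rankOne_irreducibleOrZero_holds  -- CLOSED BY NAME (v9): B-p02 p601137 (row IV-1a discharged, compact doubling)

/-- **stub (L) = the named fact `mvw_IV4_rankOne_admissible`** — Kudla's admissibility ∕ finite length of the theta lift at a NON-SPLIT place
[Kudla1986; MoeglinVignerasWaldspurger1987, Chap. 3 IV.4 2a) «de longueur finie» (chunk p0078 L24–25); GanTakeda2016 p. 473]: same binders,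
conclusion `(TwistedCoinv.rep χ ω_s _).IsAdmissible` (smooth ∧ `K`-fixed vectors finite-dimensional for compact open `K`).  For the COMPACT member
`E_v¹` this is a SUPPORT BOUND in the lattice ∕ Schrödinger model (the `χ`-coinvariants are the `χ`-isotypic summand).  Closed by
`theorem mvw_IV4_rankOne_admissible_holds` (KEY `b4-kudla-admissible-nonsplit`).  Tree has: `Representation.IsAdmissible` (SmoothRepresentation.lean),
`SchwartzBruhat`, `LatticeModel*`, `isCompact_localInt` ∕ `isOpen_localInt`; lacks: the support lemma.
[cite: MoeglinVignerasWaldspurger1987, Chap. 3 IV.4 Thm principal 2a)] -/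
theorem stub_mvw_IV4_rankOne_admissible : mvw_IV4_rankOne_admissible :=
  mvw_IV4_rankOne_admissible_holds  -- CLOSED BY NAME (v8): B-p03 p595885 (row IV-1b discharged)

/-- **stub (L) = the named fact `mvw_IV2_rankOne_nonvanishing_of_isotropic`** — stable-range occurrence for `(U(1), U(V))` at a NON-SPLIT place
[MoeglinVignerasWaldspurger1987, Chap. 3 IV.2 Lemme + Remarque b) (chunk p0076 L12, L37–40)]: same binders + `N ≥ 2`, `J` hermitian non-degenerate,
`(E_vᴺ, J)` ISOTROPIC: `Nontrivial (TwistedCoinv.Coinv (ω_s ∘ localCenter) χ)`.  `Continuous χ` is load-bearing.  Closed by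
`theorem mvw_IV2_rankOne_nonvanishing_of_isotropic_holds` (KEY `b4-stable-range-occurrence`: orbit-evaluation functional; mixed model not needed as
an object).  Tree has: implementers for every symplectic `g` (`ImplementerSection`), `TwistedCoinv.lift`-type API, Haar on compact `E_v¹`; lacks:
the mixed-model formulas (MVW Chap. 2 II.7).
[cite: MoeglinVignerasWaldspurger1987, Chap. 3 IV.2 Lemme + Remarque b)] -/
theorem stub_mvw_IV2_rankOne_nonvanishing_of_isotropic : mvw_IV2_rankOne_nonvanishing_of_isotropic :=
  mvw_IV2_rankOne_nonvanishing_of_isotropic_holds  -- CLOSED BY NAME (v7): B-p04 p593652, first named-fact discharge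

/-- **fact-stub (3a) = interface fact IV-3(a) `Liu2021.splitPlace_chiCoinv_iso_parabolicIndGL`** (B-typ01 p590532; the SPLIT-PLACE
MODEL: at a split place the `χ`-coinvariants of `ω_s` read on `GL_n(E_w)` are `parabolicIndGL … ((trivial).twist (maxParabolicLeviChar … ν (χ′ν^{1-n})))`
for unitary `ν, χ′`) — byte-identical to stub (a) of the sub-skeleton `b4-split-place-model` (c90a4bde36588b30; KEY B-p08 `b4-split-place-model`,
closed by `theorem splitPlace_chiCoinv_iso_parabolicIndGL_holds`). [cite: Liu2021, App. D, proof of Lemma D.1 (first paragraph), p. 126; GelbartRogawski1990, §2.6] -/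
theorem stub_splitPlace_chiCoinv_iso_parabolicIndGL : splitPlace_chiCoinv_iso_parabolicIndGL :=
  splitPlace_chiCoinv_iso_parabolicIndGL_holds

/-- **fact-stub (3b) = interface fact IV-3(b) `Zelevinsky1980.parabolicIndGL_detChar_unitary_isIrreducible`** (p589979; irreducibility of
unitary parabolic induction from the `(n-1,1)` parabolic, universe pinned to `Type`) — byte-identical to stub (b) of `b4-split-place-model`
(KEY B-p09 `b4-unitary-induction-irreducible`, closed by `theorem parabolicIndGL_detChar_unitary_isIrreducible_holds`). [cite: Zelevinsky1980, Thm. 4.2] -/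
theorem stub_parabolicIndGL_detChar_unitary_isIrreducible : Zelevinsky1980.parabolicIndGL_detChar_unitary_isIrreducible.{0} :=
  Zelevinsky1980.parabolicIndGL_detChar_unitary_isIrreducible_holds.{0}  -- CLOSED BY NAME (v9): B-p09 p601139 (row IV-3b discharged)

include hVd hn hχ₁n hχ₁c in
/-- **stub (XL) — the SPLIT-PLACE MODEL and its three consequences, `TwistedCoinv` currency** [Liu2021, App. D, proof of Lem. D.1, l. 5253
(= p. 126): «We identify U(V) with GL_n(F) … write μ = ν ⊠ ν⁻¹ … ω(μ, ε, χ) is isomorphic to the unitary induction from P_{n−1,1}(F) to GL_n(F)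
of the (unitary) character (ν∘det) ⊠ χν^{1−n}. See for example [GR90] 2.6.»; Zelevinsky1980 Thm 4.2 + Ex. 3.2 (irreducible iff segments not
linked — never linked for unitary `ν, χ`)]: at a place `v` SPLIT in `E` (`E_v = F_v × F_v`, `U(V)(F_v) ≅ GL_n(F_v)` via
`UnitaryGroup.localPiSplitEquiv`, centre `≅ F_vˣ` NON-compact) the `χ_{1,v}`-coinvariant quotient of `ω_v = 𝓢.omegaLoc v` is irreducible-or-zero,
admissible, and NON-ZERO — FOR A FAMILY `𝓢` WHOSE LOCAL WEIL REPRESENTATION AT `v` IS UNITARY (`L²(μ'ⁿ)`-isometric for a Haar measure `μ'`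
on `F_v`, `Representation.IsL2Isometric`, Automorphic/SchwartzBruhatL2Norm.lean; the CM families ARE: `GRConstruction.isL2Isometric_omegaLoc_congrW_undoubledSplittings_cmFinLocalFamily`,
GelbartRogawski1991/UndoubledSplittingsUnitary.lean:159 — A-side discharge for `chiLocalSplittingsD`).  WITHOUT the unitarity hypothesis the statement is FALSE
for the generic telescope `𝓢` (twist the section at `v` by `|det|_w^{±1/2}`: reducible non-zero quotient at a reducibility point of the degenerate principal
series — tree `Liu2021/LemD1DataOfPlaceIsometric.lean` header l. 17–28 and `forall_lemD1_1AsPrinted_iff_of_isL2Isometric` :169; ref2 HOLD 2026-08-28T00:34:41Z;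
v4 repair).  Becomes three instantiations when B-typ01 files IV-3(a) (`∃ ν χ′ unitary, AreIsomorphicRep (Θ_s(χ) read on GL_n)
(parabolicIndGL … c_{n−1,1} ((ν∘det) ⊠ χ′ν^{1−n}))`) and IV-3(b) (`Zelevinsky1980/UnitaryCharacterInduction`), with `Representation.isAdmissible_parabolicIndGL`
(ParabolicGL.lean:639, CITE); sub-skeleton `b4-split-place-model` (KEY reserve).  Tree has: `parabolicIndGL` (ParabolicGL.lean:611),
`localPiSplitEquiv`, the eigen-Lagrangian polarisation at split places (`FinLocalSplittingsSplitSpherical*`, `LocalUnitarySplitPlaceDarboux`); lacks: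
the model isomorphism (mirabolic Frobenius reciprocity for `𝒮(F_vⁿ)` under twisted homotheties; unitarity of `χ` load-bearing at `0 ∈ F_vⁿ`).
[cite: Liu2021, App. D proof of Lem. D.1 (l. 5253); GelbartRogawski1990, §2.6; Zelevinsky1980, Thm 4.2] -/
theorem stub_splitPlace_model_consequences [MeasurableSpace (v.adicCompletion F)] [BorelSpace (v.adicCompletion F)]
    (μ' : Measure (v.adicCompletion F)) [μ'.IsAddHaarMeasure] :
    ¬ IsField (LocalRing E v) → (𝓢.omegaLoc v).IsL2Isometric (Measure.pi fun _ : Fin n => μ') →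
      IsIrreducibleOrZero (TwistedCoinv.rep
        (ρW := show Representation ℂ (localPi E c 1 (JW F E a) v) (SchwartzBruhat (Fin n → v.adicCompletion F)) from
          (𝓢.omegaLoc v).comp (localCenter E c n (Matrix.reindex e e (JV ⊗ₖ JW F E a)) (JW F E a) (JW_apply_ne_zero F E a) v))
        (localCharOfCenter F E c (JW F E a) (JW_apply_ne_zero F E a) χ₁ v) (𝓢.omegaLoc v)
        (fun g z => (show Commute g (localCenter E c n (Matrix.reindex e e (JV ⊗ₖ JW F E a)) (JW F E a) (JW_apply_ne_zero F E a) v z) from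
        localCenter_comm E c n (Matrix.reindex e e (JV ⊗ₖ JW F E a)) (JW F E a) (JW_apply_ne_zero F E a) v z g).map (𝓢.omegaLoc v))) ∧
      (TwistedCoinv.rep
        (ρW := show Representation ℂ (localPi E c 1 (JW F E a) v) (SchwartzBruhat (Fin n → v.adicCompletion F)) from
          (𝓢.omegaLoc v).comp (localCenter E c n (Matrix.reindex e e (JV ⊗ₖ JW F E a)) (JW F E a) (JW_apply_ne_zero F E a) v))
        (localCharOfCenter F E c (JW F E a) (JW_apply_ne_zero F E a) χ₁ v) (𝓢.omegaLoc v)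
        (fun g z => (show Commute g (localCenter E c n (Matrix.reindex e e (JV ⊗ₖ JW F E a)) (JW F E a) (JW_apply_ne_zero F E a) v z) from
        localCenter_comm E c n (Matrix.reindex e e (JV ⊗ₖ JW F E a)) (JW F E a) (JW_apply_ne_zero F E a) v z g).map (𝓢.omegaLoc v))).IsAdmissible ∧
      Nontrivial (TwistedCoinv.Coinv
        (show Representation ℂ (localPi E c 1 (JW F E a) v) (SchwartzBruhat (Fin n → v.adicCompletion F)) from
          (𝓢.omegaLoc v).comp (localCenter E c n (Matrix.reindex e e (JV ⊗ₖ JW F E a)) (JW F E a) (JW_apply_ne_zero F E a) v)) (localCharOfCenter F E c (JW F E a) (JW_apply_ne_zero F E a) χ₁ v)) := by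
  exact splitPlace_model_consequences_of_facts F E c N e JV hcδ hδ hd hV hVd hJV a 𝓢 hn χ₁ hχ₁n hχ₁c v
    stub_splitPlace_chiCoinv_iso_parabolicIndGL stub_parabolicIndGL_detChar_unitary_isIrreducible μ'

/-- **stub (M) — hermitian spaces of rank `≥ 3` over `E_v` are isotropic** — CLOSED BY the line `b4-isotropy-rank-three`
(`HodgecmMathlib.B4.IsotropyRankThree.not_isAnisotropic_localLemD1Data_of`: u-invariant of `F_v` is `4` [Serre1973 Ch. IV §2.3 Thm 6; Lam2005
Ch. VI Thm 2.12] + trace form, rank `2n ≥ 6`); kept here as a registered stub so that the two lines are seated independently.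
[cite: MoeglinVignerasWaldspurger1987, Chap. 1 I.1; Serre1973, Ch. IV §2.3 Thm 6] -/
theorem stub_isotropic_of_three_le :
    ¬ (localLemD1Data F E c N e JV hcδ hδ hd hV hVd hJV a 𝓢 hn μ hμn hμc hμF χ₁ hχ₁n hχ₁c v).IsAnisotropic :=
  -- CLOSED (v6) by B-p01's landed theorem (p590822, line `b4-isotropy-rank-three`), statement byte-identical to v5.
  not_isAnisotropic_localLemD1Data F E c N e JV hcδ hδ hd hV hVd hJV a 𝓢 hn μ hμn hμc hμF χ₁ hχ₁n hχ₁c v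

/-- **COMPOSITION (kernel-checked): [Liu2021, Lem. D.1, first sentence + (1)] AS PRINTED at the place `v`, `n ≥ 3`**, i.e.
`LemD1_1AsPrinted (localLemD1Data … v)` — the per-place body of the binder `HypD1pp` (hD1'') and the hypothesis `hD1 v` of
`Def411WeilCarriers.rho_isIrreducible_of_lemD1AsPrinted'` (Hyp411) — from the five stubs: the three MVW facts are INSTANTIATED at the smooth
section `s := 𝓢.s v` over `iota` (`𝓢.proj_s v`, `𝓢.smooth v`), `J₁ := (a)`, `χ := χ_{1,v} = localCharOfCenter … χ₁ v` (unitary, continuous)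
— `𝓢.omegaLoc v = toRep ∘ 𝓢.s v` by `rfl` — the isotropy hypothesis of IV.2 comes from `stub_isotropic_of_three_le`, the split case from
`stub_splitPlace_model_consequences` under the UNITARITY hypothesis `hL2 : (𝓢.omegaLoc v).IsL2Isometric (μ'ⁿ)` (`μ'` any Haar measure on `F_v`;
A-side discharge at `𝓢 = chiLocalSplittingsD …`: `GRConstruction.isL2Isometric_omegaLoc_congrW_undoubledSplittings_cmFinLocalFamily … v hχu μ'` with
`letI := (borelPlaceMeasure F⁺ v).mS`, `μ' := (borelPlaceMeasure F⁺ v).μ`), and the junction (T) → (D) is `Junction.lemD1_1AsPrinted_data_of_theta` (proved above).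
`HypD1pp_of := fun … v => lemD1_1AsPrinted_localLemD1Data_of … v mvw_IV4_rankOne_irreducibleOrZero_holds … μ' hL2 … ` at `N = 3`,
`𝓢 = OmegaChiSplitting.chiLocalSplittingsD …` (A-plan2's head).
[cite: Liu2021, App. D Lemma D.1 (1) (l. 5226–5229), proof l. 5249–5266] -/
theorem lemD1_1AsPrinted_localLemD1Data_of
    (hIV4a : mvw_IV4_rankOne_irreducibleOrZero) (hIV4b : mvw_IV4_rankOne_admissible)
    (hIV2 : mvw_IV2_rankOne_nonvanishing_of_isotropic)
    [MeasurableSpace (v.adicCompletion F)] [BorelSpace (v.adicCompletion F)] (μ' : Measure (v.adicCompletion F)) [μ'.IsAddHaarMeasure]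
    (hL2 : (𝓢.omegaLoc v).IsL2Isometric (Measure.pi fun _ : Fin n => μ'))
    (hsplit : ¬ IsField (LocalRing E v) → (𝓢.omegaLoc v).IsL2Isometric (Measure.pi fun _ : Fin n => μ') →
      IsIrreducibleOrZero (TwistedCoinv.rep
        (ρW := show Representation ℂ (localPi E c 1 (JW F E a) v) (SchwartzBruhat (Fin n → v.adicCompletion F)) from
          (𝓢.omegaLoc v).comp (localCenter E c n (Matrix.reindex e e (JV ⊗ₖ JW F E a)) (JW F E a) (JW_apply_ne_zero F E a) v))
        (localCharOfCenter F E c (JW F E a) (JW_apply_ne_zero F E a) χ₁ v) (𝓢.omegaLoc v)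
        (fun g z => (show Commute g (localCenter E c n (Matrix.reindex e e (JV ⊗ₖ JW F E a)) (JW F E a) (JW_apply_ne_zero F E a) v z) from
        localCenter_comm E c n (Matrix.reindex e e (JV ⊗ₖ JW F E a)) (JW F E a) (JW_apply_ne_zero F E a) v z g).map (𝓢.omegaLoc v))) ∧
      (TwistedCoinv.rep
        (ρW := show Representation ℂ (localPi E c 1 (JW F E a) v) (SchwartzBruhat (Fin n → v.adicCompletion F)) from
          (𝓢.omegaLoc v).comp (localCenter E c n (Matrix.reindex e e (JV ⊗ₖ JW F E a)) (JW F E a) (JW_apply_ne_zero F E a) v))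
        (localCharOfCenter F E c (JW F E a) (JW_apply_ne_zero F E a) χ₁ v) (𝓢.omegaLoc v)
        (fun g z => (show Commute g (localCenter E c n (Matrix.reindex e e (JV ⊗ₖ JW F E a)) (JW F E a) (JW_apply_ne_zero F E a) v z) from
        localCenter_comm E c n (Matrix.reindex e e (JV ⊗ₖ JW F E a)) (JW F E a) (JW_apply_ne_zero F E a) v z g).map (𝓢.omegaLoc v))).IsAdmissible ∧
      Nontrivial (TwistedCoinv.Coinv
        (show Representation ℂ (localPi E c 1 (JW F E a) v) (SchwartzBruhat (Fin n → v.adicCompletion F)) from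
          (𝓢.omegaLoc v).comp (localCenter E c n (Matrix.reindex e e (JV ⊗ₖ JW F E a)) (JW F E a) (JW_apply_ne_zero F E a) v)) (localCharOfCenter F E c (JW F E a) (JW_apply_ne_zero F E a) χ₁ v)))
    (hiso : ¬ (localLemD1Data F E c N e JV hcδ hδ hd hV hVd hJV a 𝓢 hn μ hμn hμc hμF χ₁ hχ₁n hχ₁c v).IsAnisotropic) :
    LemD1_1AsPrinted (localLemD1Data F E c N e JV hcδ hδ hd hV hVd hJV a 𝓢 hn μ hμn hμc hμF χ₁ hχ₁n hχ₁c v) := by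
  have hT : IsIrreducibleOrZero (TwistedCoinv.rep
        (ρW := show Representation ℂ (localPi E c 1 (JW F E a) v) (SchwartzBruhat (Fin n → v.adicCompletion F)) from
          (𝓢.omegaLoc v).comp (localCenter E c n (Matrix.reindex e e (JV ⊗ₖ JW F E a)) (JW F E a) (JW_apply_ne_zero F E a) v))
        (localCharOfCenter F E c (JW F E a) (JW_apply_ne_zero F E a) χ₁ v) (𝓢.omegaLoc v)
        (fun g z => (show Commute g (localCenter E c n (Matrix.reindex e e (JV ⊗ₖ JW F E a)) (JW F E a) (JW_apply_ne_zero F E a) v z) from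
        localCenter_comm E c n (Matrix.reindex e e (JV ⊗ₖ JW F E a)) (JW F E a) (JW_apply_ne_zero F E a) v z g).map (𝓢.omegaLoc v))) ∧
      (TwistedCoinv.rep
        (ρW := show Representation ℂ (localPi E c 1 (JW F E a) v) (SchwartzBruhat (Fin n → v.adicCompletion F)) from
          (𝓢.omegaLoc v).comp (localCenter E c n (Matrix.reindex e e (JV ⊗ₖ JW F E a)) (JW F E a) (JW_apply_ne_zero F E a) v))
        (localCharOfCenter F E c (JW F E a) (JW_apply_ne_zero F E a) χ₁ v) (𝓢.omegaLoc v)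
        (fun g z => (show Commute g (localCenter E c n (Matrix.reindex e e (JV ⊗ₖ JW F E a)) (JW F E a) (JW_apply_ne_zero F E a) v z) from
        localCenter_comm E c n (Matrix.reindex e e (JV ⊗ₖ JW F E a)) (JW F E a) (JW_apply_ne_zero F E a) v z g).map (𝓢.omegaLoc v))).IsAdmissible ∧
      Nontrivial (TwistedCoinv.Coinv
        (show Representation ℂ (localPi E c 1 (JW F E a) v) (SchwartzBruhat (Fin n → v.adicCompletion F)) from
          (𝓢.omegaLoc v).comp (localCenter E c n (Matrix.reindex e e (JV ⊗ₖ JW F E a)) (JW F E a) (JW_apply_ne_zero F E a) v)) (localCharOfCenter F E c (JW F E a) (JW_apply_ne_zero F E a) χ₁ v)) := by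
    by_cases hf : IsField (LocalRing E v)
    · -- NON-SPLIT: the three MVW facts at the section `𝓢.s v`
      have hiso' : LemD1.IsIsotropic (LemD1OfPlace.standingData E v c n (Matrix.reindex e e (JV ⊗ₖ JW F E a)) hcδ hδ
          (Nat.le_of_succ_le hn) (reindex_kronecker_JW_hermitian F E c N e JV hV hJV a)
          (det_reindex_kronecker_JW_ne_zero F E N e JV hVd hJV a)) :=
        not_not.mp fun h => hiso ((LemD1Data.isAnisotropic_iff_not_isIsotropic _).mpr h)
      exact ⟨hIV4a F E c n δ hcδ hδ d hd _ _ (isUnit_det_gram F e hVd (isUnit_det_TW F a)) _ _ v hf (𝓢.s v) (𝓢.proj_s v)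
          (𝓢.smooth v) (JW F E a) (JW_apply_ne_zero F E a) _
          (norm_localCharOfCenter F E c (JW F E a) (JW_apply_ne_zero F E a) hχ₁n v)
          (continuous_coe_localCharOfCenter F E c (JW F E a) (JW_apply_ne_zero F E a) hχ₁c v),
        hIV4b F E c n δ hcδ hδ d hd _ _ (isUnit_det_gram F e hVd (isUnit_det_TW F a)) _ _ v hf (𝓢.s v) (𝓢.proj_s v)
          (𝓢.smooth v) (JW F E a) (JW_apply_ne_zero F E a) _
          (norm_localCharOfCenter F E c (JW F E a) (JW_apply_ne_zero F E a) hχ₁n v)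
          (continuous_coe_localCharOfCenter F E c (JW F E a) (JW_apply_ne_zero F E a) hχ₁c v),
        hIV2 F E c n δ hcδ hδ d hd _ _ (isUnit_det_gram F e hVd (isUnit_det_TW F a)) _ _ v hf (Nat.le_of_succ_le hn)
          (reindex_kronecker_JW_hermitian F E c N e JV hV hJV a) (det_reindex_kronecker_JW_ne_zero F E N e JV hVd hJV a) hiso'
          (𝓢.s v) (𝓢.proj_s v) (𝓢.smooth v) (JW F E a) (JW_apply_ne_zero F E a) _
          (norm_localCharOfCenter F E c (JW F E a) (JW_apply_ne_zero F E a) hχ₁n v)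
          (continuous_coe_localCharOfCenter F E c (JW F E a) (JW_apply_ne_zero F E a) hχ₁c v)⟩
    · -- SPLIT: the model
      exact hsplit hf hL2
  obtain ⟨h1, h2, h3⟩ := hT
  exact Junction.lemD1_1AsPrinted_data_of_theta E v c n (Matrix.reindex e e (JV ⊗ₖ JW F E a)) hcδ hδ (Nat.le_of_succ_le hn)
    (reindex_kronecker_JW_hermitian F E c N e JV hV hJV a) (det_reindex_kronecker_JW_ne_zero F E N e JV hVd hJV a) (JW F E a)
    (𝓢.omegaLoc v) (μ v) (hμn v) (hμc v) (hμF v) (localCharOfCenter F E c (JW F E a) (JW_apply_ne_zero F E a) χ₁ v)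
    (norm_localCharOfCenter F E c (JW F E a) (JW_apply_ne_zero F E a) hχ₁n v)
    (continuous_coe_localCharOfCenter F E c (JW F E a) (JW_apply_ne_zero F E a) hχ₁c v) (JW_apply_ne_zero F E a)
    (fun g z => (show Commute g (localCenter E c n (Matrix.reindex e e (JV ⊗ₖ JW F E a)) (JW F E a) (JW_apply_ne_zero F E a) v z) from
        localCenter_comm E c n (Matrix.reindex e e (JV ⊗ₖ JW F E a)) (JW F E a) (JW_apply_ne_zero F E a) v z g).map (𝓢.omegaLoc v))
    hn h1 h2 h3

end HodgecmMathlib.B4.LemD1Item1AtV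

end
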